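import Summits.KontsevichZagierPeriods.KontsevichZagierPeriods.Theorems.FermatIsogenyBetaProductSectorStubQuadStep
import Summits.KontsevichZagierPeriods.KontsevichZagierPeriods.Theorems.FermatIsogenyBetaProductSectorStubTwinDupStepChartL
import Literature.NumberTheory.Transcendental.KZProductIdeal

/-!
# `BetaProductSector` (stmt-KontsevichZagierPeriods-3898), line `registered` (v3) — stub `stub_twinDupStep`,
# part 4: the left chain of the twin-duplication move X9

Fourth part of the twin-duplication move X9 `B(a+b-½, b+½)·B(b, a+½-b) = 4^{a-b}·B(a+b-½, a+½-b)·B(a, 2b)`.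
The unweighted LEFT box `U = [(0,1)², x^{a+b-3/2}(1-x)^{b-½} y^{b-1}(1-y)^{a-b-½}]` (value `B(a+b-½,b+½)·B(b,a+½-b)`)
is carried onto the parameter triangle `Ω = {(t,m) | 0 < t < m < 1}` by ONE move of the Kontsevich–Zagier
calculus (rule (2) of Kontsevich–Zagier 2001 §1.2): the rational chart `λ(t,m) = (t(1+m)²/D̂, ((1-m)/(1+m))²)`
of part 2 (`D̂ = m(m-t)² + t(1+m)²`), giving `L = [Ω, ℓ]` with the Euler–Mellin integrand

  `ℓ = 2 · (4mt)^{a-1} (4t(m-t)(1-m²))^{2b-1} (64t)^{½-b} D̂^{-a-2b} · 2m(m²-t²)`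

(`TwinDupStep.twin_left_chain`; in the Mellin coordinates `P = 4mt/D̂`, `Q = t(m-t)²(1-m²)²/(4D̂²)` of the move this is
`2P^{a-1}Q^{b-½}` times the Jacobian `2m(m²-t²)/D̂²`). The `Real.rpow` bookkeeping of the pull-back is done by
taking logarithms. Everything is proved; no `def`, no named fact.
-/

noncomputable section

open MeasureTheory Set
open Literature.ModelTheory.ExponentialFields (IsSemialgebraic)
open MvPolynomial (aeval X C)

namespace Summit.KontsevichZagierPeriods.FermatIsogeny.BetaProductSectorStubs

open Literature.NumberTheory.Transcendental
open Literature.NumberTheory.Transcendental.KZ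

namespace TwinDupStep

/-! ## The Euler–Mellin integrands of the parameter triangle, unfolded -/

/-- The integrands `2 · (4mt)^{a-1} (4t(m-t)(1-m²))^{2b-1} (64t)^{½-b} D̂^{-a-2b} · J` of the parameter triangle
(`J` a polynomial Jacobian factor), unfolded. [folklore] -/
theorem mellin_omega_apply (a b : ℚ) (J : MvPolynomial (Fin 2) ℚ) (z : Fin 2 → ℝ) :
    KZ.mellinIntegrand (![4 * X 1 * X 0, 4 * X 0 * (X 1 - X 0) * (1 - X 1 ^ 2), 64 * X 0,
        X 1 * (X 1 - X 0) ^ 2 + X 0 * (1 + X 1) ^ 2, J] : Fin 5 → MvPolynomial (Fin 2) ℚ)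
        ![a - 1, 2 * b - 1, 1 / 2 - b, -a - 2 * b, 1] 2 z =
      2 * ((4 * z 1 * z 0) ^ ((a:ℝ) - 1) * (4 * z 0 * (z 1 - z 0) * (1 - z 1 ^ 2)) ^ (2 * (b:ℝ) - 1) *
        (64 * z 0) ^ (1 / 2 - (b:ℝ)) * (z 1 * (z 1 - z 0) ^ 2 + z 0 * (1 + z 1) ^ 2) ^ (-(a:ℝ) - 2 * b) *
        aeval z J) := by
  rw [KZ.mellinIntegrand_apply, Fin.prod_univ_five]
  simp only [Matrix.cons_val_zero, Matrix.cons_val_one, Matrix.cons_val, map_sub, map_mul, map_add, map_pow,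
    map_one, map_ofNat, MvPolynomial.aeval_X]
  push_cast
  rw [Real.rpow_one]

/-- The left integrand `ℓ` (`J = 2m(m²-t²)`), unfolded. [folklore] -/
theorem mellin_ell_apply (a b : ℚ) (z : Fin 2 → ℝ) :
    KZ.mellinIntegrand (![4 * X 1 * X 0, 4 * X 0 * (X 1 - X 0) * (1 - X 1 ^ 2), 64 * X 0,
        X 1 * (X 1 - X 0) ^ 2 + X 0 * (1 + X 1) ^ 2, 2 * X 1 * (X 1 ^ 2 - X 0 ^ 2)] :
          Fin 5 → MvPolynomial (Fin 2) ℚ) ![a - 1, 2 * b - 1, 1 / 2 - b, -a - 2 * b, 1] 2 z =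
      2 * ((4 * z 1 * z 0) ^ ((a:ℝ) - 1) * (4 * z 0 * (z 1 - z 0) * (1 - z 1 ^ 2)) ^ (2 * (b:ℝ) - 1) *
        (64 * z 0) ^ (1 / 2 - (b:ℝ)) * (z 1 * (z 1 - z 0) ^ 2 + z 0 * (1 + z 1) ^ 2) ^ (-(a:ℝ) - 2 * b) *
        (2 * z 1 * (z 1 ^ 2 - z 0 ^ 2))) := by
  rw [mellin_omega_apply]
  simp only [map_sub, map_mul, map_pow, map_ofNat, MvPolynomial.aeval_X]

/-! ## The pull-back identity of the left chart (by logarithms) -/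

/-- Pull-back of the left box integrand `x^{a+b-3/2}(1-x)^{b-½}y^{b-1}(1-y)^{a-b-½}` along the chart
`λ(t,m) = (t(1+m)²/D̂, ((1-m)/(1+m))²)`, times the Jacobian `4m(1-m)(m²-t²)/((1+m)D̂²)`: the left integrand `ℓ` of
the parameter triangle. [folklore] -/
theorem left_pullback (a b : ℝ) {t m : ℝ} (ht : 0 < t) (htm : t < m) (hm1 : m < 1) :
    1 * ((t * (1 + m) ^ 2 / (m * (m - t) ^ 2 + t * (1 + m) ^ 2)) ^ (a + b - 3 / 2) *
        (1 - t * (1 + m) ^ 2 / (m * (m - t) ^ 2 + t * (1 + m) ^ 2)) ^ (b - 1 / 2) *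
        (((1 - m) / (1 + m)) ^ 2) ^ (b - 1) * (1 - ((1 - m) / (1 + m)) ^ 2) ^ (a - b - 1 / 2)) *
      (4 * m * (1 - m) * (m ^ 2 - t ^ 2) / ((1 + m) * (m * (m - t) ^ 2 + t * (1 + m) ^ 2) ^ 2)) =
    2 * ((4 * m * t) ^ (a - 1) * (4 * t * (m - t) * (1 - m ^ 2)) ^ (2 * b - 1) * (64 * t) ^ (1 / 2 - b) *
      (m * (m - t) ^ 2 + t * (1 + m) ^ 2) ^ (-a - 2 * b) * (2 * m * (m ^ 2 - t ^ 2))) := by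
  have hm : 0 < m := lt_trans ht htm
  have h1m : 0 < 1 + m := by linarith
  have h1m' : 0 < 1 - m := by linarith
  have hmt : 0 < m - t := by linarith
  have hmt' : 0 < m + t := by linarith
  have hD : 0 < m * (m - t) ^ 2 + t * (1 + m) ^ 2 := by positivity
  have e1 : 1 - t * (1 + m) ^ 2 / (m * (m - t) ^ 2 + t * (1 + m) ^ 2) =
      m * (m - t) ^ 2 / (m * (m - t) ^ 2 + t * (1 + m) ^ 2) := by
    field_simp
    ring
  have e2 : 1 - ((1 - m) / (1 + m)) ^ 2 = 4 * m / (1 + m) ^ 2 := by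
    field_simp
    ring
  have e3 : (1:ℝ) - m ^ 2 = (1 - m) * (1 + m) := by ring
  have e4 : m ^ 2 - t ^ 2 = (m - t) * (m + t) := by ring
  have e64 : (64:ℝ) = 2 ^ 6 := by norm_num
  have e4' : (4:ℝ) = 2 ^ 2 := by norm_num
  rw [e1, e2, e3, e4, e64, e4', one_mul]
  have hl : 0 < ((t * (1 + m) ^ 2 / (m * (m - t) ^ 2 + t * (1 + m) ^ 2)) ^ (a + b - 3 / 2) *
        (m * (m - t) ^ 2 / (m * (m - t) ^ 2 + t * (1 + m) ^ 2)) ^ (b - 1 / 2) *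
        (((1 - m) / (1 + m)) ^ 2) ^ (b - 1) * ((2:ℝ) ^ 2 * m / (1 + m) ^ 2) ^ (a - b - 1 / 2)) *
      ((2:ℝ) ^ 2 * m * (1 - m) * ((m - t) * (m + t)) / ((1 + m) * (m * (m - t) ^ 2 + t * (1 + m) ^ 2) ^ 2)) := by
    positivity
  have hr : 0 < 2 * (((2:ℝ) ^ 2 * m * t) ^ (a - 1) * ((2:ℝ) ^ 2 * t * (m - t) * ((1 - m) * (1 + m))) ^ (2 * b - 1) *
      ((2:ℝ) ^ 6 * t) ^ (1 / 2 - b) * (m * (m - t) ^ 2 + t * (1 + m) ^ 2) ^ (-a - 2 * b) *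
      (2 * m * ((m - t) * (m + t)))) := by
    positivity
  rw [← Real.exp_log hl, ← Real.exp_log hr]
  congr 1
  simp (disch := positivity) only [Real.log_mul, Real.log_rpow, Real.log_div, Real.log_pow]
  ring

/-! ## The left chain -/

/-- **The left chain of the twin-duplication move**: the unweighted left box
`U = [(0,1)², x^{a+b-3/2}(1-x)^{b-½} y^{b-1}(1-y)^{a-b-½}]` (a box-Mellin member) is equivalent to a representation
`L` pinned on the parameter triangle `Ω = {0 < t < m < 1}` with the left integrand `ℓ`, WHICH EXISTS — one change
of variables along the rational chart `λ(t,m) = (t(1+m)²/D̂, ((1-m)/(1+m))²)` (rule (2)).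
[cite: KontsevichZagier2001, §1.2 rule (2)] -/
theorem twin_left_chain : ∀ (a b : ℚ) (U : Literature.NumberTheory.Transcendental.KZ.IntegralRep 2), Literature.NumberTheory.Transcendental.KZ.IsMellinMemberWith (![MvPolynomial.X 0, 1 - MvPolynomial.X 0, MvPolynomial.X 1, 1 - MvPolynomial.X 1] : Fin 4 → MvPolynomial (Fin 2) ℚ) ![a + b - 3 / 2, b - 1 / 2, b - 1, a - b - 1 / 2] 1 U → ∃ L : Literature.NumberTheory.Transcendental.KZ.IntegralRep 2, L.domain = {z : Fin 2 → ℝ | 0 < z 0 ∧ z 0 < z 1 ∧ z 1 < 1} ∧ Set.EqOn L.integrand (Literature.NumberTheory.Transcendental.KZ.mellinIntegrand (![4 * MvPolynomial.X 1 * MvPolynomial.X 0, 4 * MvPolynomial.X 0 * (MvPolynomial.X 1 - MvPolynomial.X 0) * (1 - MvPolynomial.X 1 ^ 2), 64 * MvPolynomial.X 0, MvPolynomial.X 1 * (MvPolynomial.X 1 - MvPolynomial.X 0) ^ 2 + MvPolynomial.X 0 * (1 + MvPolynomial.X 1) ^ 2, 2 * MvPolynomial.X 1 * (MvPolynomial.X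 1 ^ 2 - MvPolynomial.X 0 ^ 2)] : Fin 5 → MvPolynomial (Fin 2) ℚ) ![a - 1, 2 * b - 1, 1 / 2 - b, -a - 2 * b, 1] 2) L.domain ∧ Literature.NumberTheory.Transcendental.KZ.Equivalent U L := by
  intro a b U hU
  have hbox : ({z : Fin 2 → ℝ | z 0 ∈ Set.Ioo (0:ℝ) 1 ∧ z 1 ∈ Set.Ioo (0:ℝ) 1}) =
      {x | ∀ i, x i ∈ Set.Ioo (0:ℝ) 1} := Set.ext fun z => by simp only [mem_setOf_eq, Fin.forall_fin_two]
  have hUd : U.domain = {z : Fin 2 → ℝ | z 0 ∈ Set.Ioo (0:ℝ) 1 ∧ z 1 ∈ Set.Ioo (0:ℝ) 1} := by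
    rw [hU.1, QuadStep.mellinBox_betaBox, hbox]
  -- the chart of the box by the parameter triangle: the representation `L` on `Ω`, which exists
  obtain ⟨Φ, Φ', hΦ0, hΦ1, hsaΦ, hderivΦ, hinjΦ, himageΦ, hdetΦ⟩ := exists_chartLambda
  have hpullΦ : ∀ z ∈ {z : Fin 2 → ℝ | 0 < z 0 ∧ z 0 < z 1 ∧ z 1 < 1},
      KZ.mellinIntegrand (![4 * X 1 * X 0, 4 * X 0 * (X 1 - X 0) * (1 - X 1 ^ 2), 64 * X 0,
          X 1 * (X 1 - X 0) ^ 2 + X 0 * (1 + X 1) ^ 2, 2 * X 1 * (X 1 ^ 2 - X 0 ^ 2)] :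
            Fin 5 → MvPolynomial (Fin 2) ℚ) ![a - 1, 2 * b - 1, 1 / 2 - b, -a - 2 * b, 1] 2 z =
        U.integrand (Φ z) * |(Φ' z).det| := by
    intro z hz
    have hΦz : Φ z ∈ U.domain := by
      rw [hUd, ← himageΦ]
      exact mem_image_of_mem Φ hz
    rw [hdetΦ z hz, mellin_ell_apply, hU.2 hΦz, QuadStep.mellin_betaBox_apply, hΦ0, hΦ1]
    simp only [Matrix.cons_val_zero, Matrix.cons_val_one, Matrix.cons_val]
    push_cast
    exact (left_pullback _ _ hz.1 hz.2.1 hz.2.2).symm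
  have hposL : ∀ z ∈ {z : Fin 2 → ℝ | 0 < z 0 ∧ z 0 < z 1 ∧ z 1 < 1}, ∀ k, 0 < aeval z
      ((![4 * X 1 * X 0, 4 * X 0 * (X 1 - X 0) * (1 - X 1 ^ 2), 64 * X 0,
          X 1 * (X 1 - X 0) ^ 2 + X 0 * (1 + X 1) ^ 2, 2 * X 1 * (X 1 ^ 2 - X 0 ^ 2)] :
            Fin 5 → MvPolynomial (Fin 2) ℚ) k) := by
    rintro z ⟨h0, h01, h1⟩ k
    have hm : 0 < z 1 := lt_trans h0 h01
    have hm2 : 0 < 1 - z 1 ^ 2 := by nlinarith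
    have hmt : 0 < z 1 ^ 2 - z 0 ^ 2 := by nlinarith
    fin_cases k
    · simp only [Fin.zero_eta, Matrix.cons_val_zero, map_mul, map_ofNat, MvPolynomial.aeval_X]
      positivity
    · simp only [Fin.mk_one, Matrix.cons_val_one, Matrix.cons_val_zero, map_mul, map_sub, map_pow, map_one,
        map_ofNat, MvPolynomial.aeval_X]
      exact mul_pos (mul_pos (by positivity) (sub_pos.2 h01)) hm2
    · simp only [Fin.reduceFinMk, Matrix.cons_val, map_mul, map_ofNat, MvPolynomial.aeval_X]
      positivity
    · simp only [Fin.reduceFinMk, Matrix.cons_val, map_add, map_mul, map_sub, map_pow, map_one,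
        MvPolynomial.aeval_X]
      exact denomL_pos h0.le hm h1.le
    · simp only [Fin.reduceFinMk, Matrix.cons_val, map_mul, map_sub, map_pow, map_ofNat, MvPolynomial.aeval_X]
      positivity
  have hintL : IntegrableOn (KZ.mellinIntegrand (![4 * X 1 * X 0, 4 * X 0 * (X 1 - X 0) * (1 - X 1 ^ 2), 64 * X 0,
      X 1 * (X 1 - X 0) ^ 2 + X 0 * (1 + X 1) ^ 2, 2 * X 1 * (X 1 ^ 2 - X 0 ^ 2)] :
        Fin 5 → MvPolynomial (Fin 2) ℚ) ![a - 1, 2 * b - 1, 1 / 2 - b, -a - 2 * b, 1] 2)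
      {z : Fin 2 → ℝ | 0 < z 0 ∧ z 0 < z 1 ∧ z 1 < 1} := by
    have key := (integrableOn_image_iff_integrableOn_abs_det_fderiv_smul volume
      QuadStep.isSemialgebraic_wedge.measurableSet_holds (fun z hz => (hderivΦ z hz).hasFDerivWithinAt) hinjΦ
      U.integrand).1 (by rw [himageΦ, ← hUd]; exact U.integrableOn)
    refine key.congr_fun (fun z hz => ?_) QuadStep.isSemialgebraic_wedge.measurableSet_holds
    change |(Φ' z).det| • U.integrand (Φ z) = _
    rw [hpullΦ z hz, smul_eq_mul, mul_comm]
  let L : KZ.IntegralRep 2 := ⟨{z : Fin 2 → ℝ | 0 < z 0 ∧ z 0 < z 1 ∧ z 1 < 1}, _,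
    QuadStep.isSemialgebraic_wedge, KZ.isSemialgebraicFunOn_mellinIntegrand QuadStep.isSemialgebraic_wedge _ _ 2 hposL,
    hintL⟩
  have relΦ : of L - of U ∈ relations :=
    changeOfVariablesRel_subset_relations ⟨2, L, U, Φ, Φ', hsaΦ, fun z hz => (hderivΦ z hz).hasFDerivWithinAt,
      hinjΦ, by rw [hUd]; exact himageΦ.symm, fun z hz => hpullΦ z hz, rfl⟩
  refine ⟨L, rfl, fun z _ => rfl, ?_⟩
  have e : of U - of L = -(of L - of U) := by abel
  show of U - of L ∈ relations
  rw [e]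
  exact relations.neg_mem relΦ

end TwinDupStep

end Summit.KontsevichZagierPeriods.FermatIsogeny.BetaProductSectorStubs

end
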